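/-
Origin: expansion seat `planner-pub-hodgecm-pv13-g5-0`, handover #3 2026-08-18T13:1xZ (md5 865dc4212e88bf347d2f506a84492a72; NEW additive leaf; ZERO import rewrites — imports the INSTALLED tree modules HodgeCM.PerL34.GenuineSchrodingerModel (RUN 29 row 6d0063d7), HodgeCM.PerL34.LocalFactors.SchrodingerIrreducible (r28), HodgeCM.PerL34.RestrictedMeasureBorel, HodgeCM.PerL34.LocTorusCompact; land AFTER HodgeCM/PerL34/GenuineSchrodingerModel.lean; HOLD iff that RU (`HOME/pub-hodgecm-pv13-g5/lean/Pv13g5/GenuineSchrodingerRigid.lean`, md5 865dc421, 485 lines);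
landed by the gen-8 packager in gate run 30 as `HodgeCM/PerL34/GenuineSchrodingerRigid.lean` (verbatim).
-/
/-
Copyright (c) 2026. All rights reserved.
Released under Apache 2.0 license as described in the file LICENSE.
Authors: unit pub-hodgecm-pv13-g5 (DAG-NODE PROVER #13, seam S3, 𝓕-side).

# HodgeCM/PerL34/GenuineSchrodingerRigid.lean — the GLOBAL split Schrödinger model is RIGID:
# adelic Stone–von Neumann on `L²(X)` and uniqueness of the Levi action up to a character
-/
import Summits.HodgeConjecture.HodgeCM.PerL34.GenuineSchrodingerModel_2
import Summits.HodgeConjecture.HodgeCM.PerL34.LocalFactors.SchrodingerIrreducible_3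
import Summits.HodgeConjecture.HodgeCM.PerL34.RestrictedMeasureBorel_2
import Summits.HodgeConjecture.HodgeCM.PerL34.LocTorusCompact_2

/-!
# Rigidity of the global split Schrödinger model `L²(X)`, `X = Πʳ_{v split} [(L⁺_v)³, 𝒪_v³]`

`HodgeCM/PerL34/GenuineSchrodingerModel.lean` (gate RUN 29) builds the GENUINE global model of the
doubling/Weil representation at the split places: the Hilbert space `L²(X, dx)` on the restricted
product `X = Space L` with its product Haar measure `μ L` (`vol ∏_v 𝒪_v³ = 1`) and, for every
continuous unitary character `ν` of the model group `U(1)(𝔸_{L⁺}) = Model L`, the unitary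
representation `rep L ν = dilationRep (μ L) ν`,
`(rep L ν k f)(x) = ν(k) · δ_X(k)^{1/2} · f(k⁻¹ • x)`.
The two files `HodgeCM/PerL34/LocalFactors/SchrodingerLevi.lean` (RUN 27) and
`HodgeCM/PerL34/LocalFactors/SchrodingerIrreducible.lean` (RUN 28) prove, for ONE local field
`F = L⁺_v` and `X_v = F^n`, that this shape is FORCED: irreducibility of the Schrödinger
representation of the Heisenberg group (Stone–von Neumann, in the form "the translations and the
Heisenberg modulations have scalar commutant on `L²`") plus Schur's lemma give that every unitary
representation of the Levi factor normalising the Heisenberg operators correctly is `dilationRep ν`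
for a UNIQUE unitary character `ν` — PerL v5 Lemma 4.2 (b), split sentence (tex ll. 610–611, quoted
verbatim):

  "`\U(W_i)(L_{0,v})` is compact unless `v` splits in `L`, where it is `L_{0,v}^\times` acting on
  `\cS(L_{0,v}^3)` by `(\omega(y)\phi)(x)=|y|^{3/2}\phi(yx)` up to a unitary character".

This file proves the ADELIC counterpart, i.e. the same rigidity for the GLOBAL model `L²(X)` of
RUN 29 over the restricted product of ALL split places at once (PerL v5 tex ll. 259–263: the global
Weil representation `ω_{W,μ} = ω_{ψ,χ_V,μ}` of `U(W)(𝔸) × G_U(𝔸)` is a representation on functions on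
an ADELIC space, of which `X` is the split part):

* §1  `X` is second countable (countably many split places, each `(L⁺_v)³` second countable:
  `HodgeCM/PerL34/RestrictedMeasureBorel.lean`), so the `L²` machinery of RUN 28 applies to it.
* §2  A countable basis of COMPACT OPEN SUBGROUPS `levelBall L k ⊆ ∏_v 𝒪_v³` of `0 ∈ X`
  (`‖u_v‖ ≤ 2^{-k}` at the first `k` split places of a fixed enumeration, `‖u_v‖ ≤ 1` elsewhere):
  open, compact, antitone, and cofinal in `𝓝 0` (`levelBall_nhds`, via Mathlib's description
  `RestrictedProduct.nhds_zero_eq_map_structureMap` of `𝓝 0` in a restricted product).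
* §3  The adelic COORDINATE HEISENBERG CHARACTERS `u ↦ ψ_v(s · u_{v,j})` (one split place `v`, one
  coordinate `j`, `s ∈ L⁺_v`; these are the characters `u ↦ ψ_𝔸(⟨u, ξ⟩)` for `ξ = s·e_{v,j} ∈ X`),
  for ANY family `ψ = (ψ_v)` of non-trivial continuous unitary additive characters; they are
  PERMUTED by the Levi action (`adelicCoordChar_comp_smulMap`: `M_{v,j,s} ∘ (k•·) = M_{v,j,s·k_v}`,
  so the set `coordCharSet` is Levi-stable) and SEPARATE points from the `levelBall`s
  (`exists_adelicCoordChar_sep`, from the RUN-28 local lemma `exists_mul_sep`).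
* §4  **`hasScalarCommutant_schrodingerSystem_space`** — ADELIC STONE–VON NEUMANN on `L²(X)`: the
  translations `τ_y`, `y ∈ X`, together with the modulations by any set `𝓜` of characters containing
  the coordinate Heisenberg characters have SCALAR COMMUTANT in `B(L²(X))` (an instance of the RUN-28
  theorem `hasScalarCommutant_schrodingerSystem` for the locally compact, second countable abelian
  group `X` with the basis of §2 and the countable separating family of §3).
* §5  **`rep_unique_up_to_character`** — PerL L4.2(b) split sentence, ADELICALLY: every unitary
  representation `ω` of `Model L = U(1)(𝔸_{L⁺})` on `L²(X)` that normalises the adelic Heisenberg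
  operators the way the Weil representation does (`ω(k) τ_y ω(k)⁻¹ = τ_{k⁻¹•y}`,
  `ω(k) M_χ ω(k)⁻¹ = M_{χ ∘ (k • ·)}`) IS `rep L ν` of RUN 29 for a UNIQUE unitary
  character `ν : Model L →* Circle`; consumer form `rep_unique_up_to_character_coord` (hypotheses
  = the two Heisenberg commutation relations `ω(k) τ_y = τ_{k⁻¹•y} ω(k)`,
  `ω(k) M_{v,j,s} = M_{v,j,s·k_v} ω(k)` and nothing else); converse `rep_translate` / `rep_modulate`
  (every `rep L ν` satisfies them) and the characterisation `exists_eq_rep_iff`; the matrix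
  coefficients of such an `ω` on indicator functions are forced (`rep_unique_inner_indicator`).  So
  the RUN-29 representation `rep L ν` is not a choice: it is the only possibility compatible with
  the Heisenberg normalisation, exactly as in print.

ABSOLUTE RULE.  Nothing is cited and nothing is posited: every statement below is kernel-proved
from Mathlib and the landed package files named above; no PerL / QW8 / 2001-programme claim enters
as a hypothesis.  The hypotheses of §4–§5 are DATA the caller supplies (a family of non-trivial
continuous additive characters `ψ_v`, a set `𝓜` of modulation characters containing the coordinate
ones, and — in §5 — a representation `ω` with the two displayed normalisation identities).
-/

set_option autoImplicit false

noncomputable section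

open MeasureTheory MeasureTheory.Measure Set Metric Function Complex Topology Filter
open scoped RestrictedProduct InnerProductSpace NNReal ENNReal

namespace HodgeCM.PerL34.PureTensor.SchrodingerModel

open HodgeCM.PerL34.LocalFactors HodgeCM.PerL34.LocalFactors.DilationModel
open HodgeCM.PerL34.LocalFactors.SchrodingerLevi HodgeCM.PerL34.LocalFactors.SchrodingerIrreducible
open HodgeCM.PerL34.IdelePlaces HodgeCM.PerL34.IdelicTorusModel HodgeCM.PerL34.IdelicTorusModel.Genuine
open NumberField IsDedekindDomain

attribute [local instance] LocalFactors.DilationModel.Adic.nontriviallyNormedField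
  LocalFactors.DilationModel.Adic.properSpace

variable {L : Type} [Field L] [NumberField L] [IsCMField L]

local notation3 "L⁺" => maximalRealSubfield L

/-! ## §1  `X` is second countable -/

/-- `X = Πʳ_{v split} [(L⁺_v)³, 𝒪_v³]` is second countable: countably many (split) places and each
`(L⁺_v)³` second countable. -/
instance secondCountableTopology_space : SecondCountableTopology (Space L) :=
  RestrictedMeasure.secondCountableTopology (fun i => (cube L i : Set (Coord L i)))
    fun i => (cube L i).isOpen

/-! ## §2  A countable basis of compact open subgroups of `0 ∈ X` -/

variable (L) in
/-- a fixed injective enumeration index of the (countably many) split places -/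
def enumIdx : SplitIdx L → ℕ := Classical.choose (Countable.exists_injective_nat (SplitIdx L))

variable (L) in
/-- (Ported verbatim from the HodgeCMPerL package; no docstring in the source.) -/
theorem enumIdx_injective : Injective (enumIdx L) :=
  Classical.choose_spec (Countable.exists_injective_nat (SplitIdx L))

variable (L) in
/-- the set of split places of enumeration index `< k` is finite -/
theorem finite_enumIdx_lt (k : ℕ) : {i : SplitIdx L | enumIdx L i < k}.Finite :=
  (Set.finite_lt_nat k).preimage (enumIdx_injective L).injOn

variable (L) in
/-- the radius profile of the `k`-th level ball: `2^{-k}` at the places of index `< k`, `1` elsewhere -/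
def rad (k : ℕ) (i : SplitIdx L) : ℝ := if enumIdx L i < k then (1 / 2 : ℝ) ^ k else 1

/-- (Ported verbatim from the HodgeCMPerL package; no docstring in the source.) -/
theorem rad_of_lt {k : ℕ} {i : SplitIdx L} (h : enumIdx L i < k) : rad L k i = (1 / 2 : ℝ) ^ k :=
  if_pos h

/-- (Ported verbatim from the HodgeCMPerL package; no docstring in the source.) -/
theorem rad_of_not_lt {k : ℕ} {i : SplitIdx L} (h : ¬ enumIdx L i < k) : rad L k i = 1 :=
  if_neg h

variable (L) in
/-- (Ported verbatim from the HodgeCMPerL package; no docstring in the source.) -/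
theorem rad_pos (k : ℕ) (i : SplitIdx L) : 0 < rad L k i := by
  unfold rad; split_ifs <;> positivity

variable (L) in
/-- (Ported verbatim from the HodgeCMPerL package; no docstring in the source.) -/
theorem rad_le_one (k : ℕ) (i : SplitIdx L) : rad L k i ≤ 1 := by
  unfold rad; split_ifs
  · exact pow_le_one₀ (by norm_num) (by norm_num)
  · exact le_rfl

variable (L) in
/-- (Ported verbatim from the HodgeCMPerL package; no docstring in the source.) -/
theorem pow_le_rad (k : ℕ) (i : SplitIdx L) : (1 / 2 : ℝ) ^ k ≤ rad L k i := by
  unfold rad; split_ifs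
  · exact le_rfl
  · exact pow_le_one₀ (by norm_num) (by norm_num)

/-- the radius profile is antitone in the level -/
theorem rad_anti {k j : ℕ} (hkj : k ≤ j) (i : SplitIdx L) : rad L j i ≤ rad L k i := by
  by_cases hk : enumIdx L i < k
  · rw [rad_of_lt hk, rad_of_lt (lt_of_lt_of_le hk hkj)]
    exact pow_le_pow_of_le_one (by norm_num) (by norm_num) hkj
  · rw [rad_of_not_lt hk]; exact rad_le_one L j i

variable (L) in
/-- **the `k`-th level ball** `B_k = {u ∈ X : ‖u_v‖ ≤ rad k v for all v} ⊆ ∏_v 𝒪_v³`, an additive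
subgroup of `X` (each `(L⁺_v)³` is ultrametric) -/
def levelBall (k : ℕ) : AddSubgroup (Space L) where
  carrier := {u | ∀ i, ‖u i‖ ≤ rad L k i}
  add_mem' {u w} hu hw i := by
    rw [RestrictedProduct.add_apply]
    exact (IsUltrametricDist.norm_add_le_max _ _).trans (max_le (hu i) (hw i))
  zero_mem' i := by rw [RestrictedProduct.zero_apply, norm_zero]; exact (rad_pos L k i).le
  neg_mem' {u} hu i := by rw [RestrictedProduct.neg_apply, norm_neg]; exact hu i

/-- (Ported verbatim from the HodgeCMPerL package; no docstring in the source.) -/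
theorem mem_levelBall_iff {k : ℕ} {u : Space L} : u ∈ levelBall L k ↔ ∀ i, ‖u i‖ ≤ rad L k i :=
  Iff.rfl

variable (L) in
/-- (Ported verbatim from the HodgeCMPerL package; no docstring in the source.) -/
theorem coe_levelBall (k : ℕ) :
    (levelBall L k : Set (Space L)) = {u | ∀ i, ‖u i‖ ≤ rad L k i} := rfl

variable (L) in
/-- every level ball lies in the box `∏_v 𝒪_v³` -/
theorem levelBall_subset_box (k : ℕ) : (levelBall L k : Set (Space L)) ⊆ (box L : Set (Space L)) :=
  fun _ hu i => (mem_cube_iff L i _).2 ((hu i).trans (rad_le_one L k i))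

variable (L) in
/-- the coordinate "closed balls" `{u ∈ X : ‖u_v‖ ≤ r}`, `r > 0`, are open (ultrametric place) -/
theorem isOpen_norm_apply_le (i : SplitIdx L) {r : ℝ} (hr : 0 < r) :
    IsOpen {u : Space L | ‖u i‖ ≤ r} := by
  have h : {u : Space L | ‖u i‖ ≤ r} = (fun u : Space L => u i) ⁻¹' Metric.closedBall 0 r := by
    ext u; simp
  rw [h]
  exact (IsUltrametricDist.isOpen_closedBall _ hr.ne').preimage (RestrictedProduct.continuous_eval i)

variable (L) in
/-- the level ball as the box cut by finitely many coordinate conditions -/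
theorem coe_levelBall_eq_inter (k : ℕ) :
    (levelBall L k : Set (Space L)) = (box L : Set (Space L)) ∩
      ⋂ i ∈ {i : SplitIdx L | enumIdx L i < k}, {u : Space L | ‖u i‖ ≤ (1 / 2 : ℝ) ^ k} := by
  ext u
  simp only [coe_levelBall, mem_setOf_eq, mem_inter_iff, mem_iInter, mem_box_iff]
  constructor
  · intro hu
    refine ⟨fun i => (mem_cube_iff L i _).2 ((hu i).trans (rad_le_one L k i)), fun i hi => ?_⟩
    rw [← rad_of_lt hi]; exact hu i
  · rintro ⟨hb, hk⟩ i
    by_cases hi : enumIdx L i < k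
    · rw [rad_of_lt hi]; exact hk i hi
    · rw [rad_of_not_lt hi]; exact (mem_cube_iff L i _).1 (hb i)

variable (L) in
/-- the level balls are open -/
theorem isOpen_levelBall (k : ℕ) : IsOpen (levelBall L k : Set (Space L)) := by
  rw [coe_levelBall_eq_inter]
  exact (isOpen_box L).inter ((finite_enumIdx_lt L k).isOpen_biInter fun i _ =>
    isOpen_norm_apply_le L i (by positivity))

variable (L) in
/-- the level balls are closed -/
theorem isClosed_levelBall (k : ℕ) : IsClosed (levelBall L k : Set (Space L)) := by
  rw [coe_levelBall, Set.setOf_forall]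
  exact isClosed_iInter fun i =>
    isClosed_le ((continuous_norm).comp (RestrictedProduct.continuous_eval i)) continuous_const

variable (L) in
/-- the level balls are compact (closed subsets of the compact box `∏_v 𝒪_v³`) -/
theorem isCompact_levelBall (k : ℕ) : IsCompact (levelBall L k : Set (Space L)) :=
  (box L).isCompact.of_isClosed_subset (isClosed_levelBall L k) (levelBall_subset_box L k)

variable (L) in
/-- the level balls decrease -/
theorem levelBall_antitone : Antitone (levelBall L) :=
  fun _ _ hkj _ hu i => (hu i).trans (rad_anti hkj i)

variable (L) in
/-- **the level balls are cofinal in the neighbourhood filter of `0 ∈ X`**: the topology of the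
restricted product at `0` is the product topology of `∏_v 𝒪_v³`
(`RestrictedProduct.nhds_zero_eq_map_structureMap`), a basic product neighbourhood constrains finitely
many places `I` to balls of radii `ε_v > 0`, and the level `k = 1 + max(max_{v∈I} index(v), max_v m_v)`
with `2^{-m_v} < ε_v` works. -/
theorem levelBall_nhds (U : Set (Space L)) (hU : U ∈ 𝓝 (0 : Space L)) :
    ∃ k, (levelBall L k : Set (Space L)) ⊆ U := by
  classical
  have h0 : RestrictedProduct.structureMap (Coord L) (fun i => (cube L i : Set (Coord L i))) cofinite
      (0 : Π i, cube L i) = (0 : Space L) := by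
    ext i; rfl
  have h1 : U ∈ Filter.map
      (RestrictedProduct.structureMap (Coord L) (fun i => (cube L i : Set (Coord L i))) cofinite)
      (𝓝 (0 : Π i, cube L i)) := by
    have h := RestrictedProduct.nhds_zero_eq_map_structureMap (R := Coord L) (B := fun i => cube L i)
      (fact_isOpen_cube L).out
    rw [h0] at h
    rw [← h]; exact hU
  rw [Filter.mem_map, nhds_pi, Filter.mem_pi'] at h1
  obtain ⟨I, t, ht, hsub⟩ := h1
  -- per place in `I`: an exponent `m_v` with `ball 0 2^{-m_v} ⊆ t_v` and `index(v) < m_v`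
  have hε : ∀ i : SplitIdx L, ∃ m : ℕ, i ∈ I →
      enumIdx L i < m ∧ Metric.ball (0 : cube L i) ((1 / 2 : ℝ) ^ m) ⊆ t i := by
    intro i
    by_cases hi : i ∈ I
    · obtain ⟨ε, hε, hball⟩ := Metric.mem_nhds_iff.1 (ht i)
      obtain ⟨m, hm⟩ := exists_pow_lt_of_lt_one hε (by norm_num : (1 / 2 : ℝ) < 1)
      refine ⟨max m (enumIdx L i + 1), fun _ => ⟨?_, ?_⟩⟩
      · exact lt_of_lt_of_le (Nat.lt_succ_self _) (le_max_right _ _)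
      · exact (Metric.ball_subset_ball
          ((pow_le_pow_of_le_one (by norm_num) (by norm_num) (le_max_left _ _)).trans hm.le)).trans
          hball
    · exact ⟨0, fun h => absurd h hi⟩
  choose m hm using hε
  refine ⟨I.sup m + 1, fun u hu => ?_⟩
  have hub : ∀ i, u i ∈ cube L i := fun i => (mem_cube_iff L i _).2 ((hu i).trans (rad_le_one L _ i))
  set c : Π i, cube L i := fun i => ⟨u i, hub i⟩ with hc_def
  have hcu : RestrictedProduct.structureMap (Coord L) (fun i => (cube L i : Set (Coord L i))) cofinite
      c = u := by
    ext i; rfl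
  have hc : c ∈ (↑I : Set (SplitIdx L)).pi t := by
    intro i hi
    obtain ⟨h1, h2⟩ := hm i (Finset.mem_coe.1 hi)
    apply h2
    have hidx : enumIdx L i < I.sup m + 1 :=
      lt_of_lt_of_le h1 ((Finset.le_sup (f := m) (Finset.mem_coe.1 hi)).trans (Nat.le_succ _))
    have hui : ‖u i‖ ≤ (1 / 2 : ℝ) ^ (I.sup m + 1) := by rw [← rad_of_lt hidx]; exact hu i
    rw [Metric.mem_ball, Subtype.dist_eq, show ((0 : cube L i) : Coord L i) = 0 from rfl,
      dist_zero_right]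
    calc ‖(c i : Coord L i)‖ = ‖u i‖ := rfl
      _ ≤ (1 / 2 : ℝ) ^ (I.sup m + 1) := hui
      _ < (1 / 2 : ℝ) ^ (I.sup m) := pow_lt_pow_right_of_lt_one₀ (by norm_num) (by norm_num)
          (Nat.lt_succ_self _)
      _ ≤ (1 / 2 : ℝ) ^ m i := pow_le_pow_of_le_one (by norm_num) (by norm_num)
          (Finset.le_sup (f := m) (Finset.mem_coe.1 hi))
  have hcU := hsub hc
  rwa [Set.mem_preimage, hcu] at hcU

/-! ## §3  The adelic coordinate Heisenberg characters and their separation property -/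

section Characters

variable (ψ : ∀ i : SplitIdx L, AddChar ((basePlaceOf L i.1).adicCompletion (maximalRealSubfield L)) Circle)
  (hψc : ∀ i, Continuous (ψ i))

/-- **adelic coordinate Heisenberg character** `u ↦ ψ_v(s · u_{v,j})` of `X` (one split place `v`,
one coordinate `j ∈ Fin 3`, multiplier `s ∈ L⁺_v`): the Heisenberg modulation character
`u ↦ ψ_𝔸(⟨u, ξ⟩)` for the vector `ξ = s · e_{v,j} ∈ X` supported at the single place `v`. -/
def adelicCoordChar (i : SplitIdx L) (j : Fin 3) (s : (basePlaceOf L i.1).adicCompletion (maximalRealSubfield L)) :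
    C(Space L, Circle) :=
  (coordChar (ψ i) (hψc i) j s).comp ⟨fun u : Space L => u i, RestrictedProduct.continuous_eval i⟩

/-- (Ported verbatim from the HodgeCMPerL package; no docstring in the source.) -/
@[simp]
theorem adelicCoordChar_apply (i : SplitIdx L) (j : Fin 3)
    (s : (basePlaceOf L i.1).adicCompletion (maximalRealSubfield L)) (u : Space L) :
    adelicCoordChar ψ hψc i j s u = ψ i (s * u i j) := by
  simp [adelicCoordChar, coordChar_apply]

/-- **the coordinate Heisenberg characters are permuted by the Levi action**:
`ψ_v(s · (k • u)_{v,j}) = ψ_v((s k_v) · u_{v,j})`, i.e. `M_{v,j,s} ∘ (k • ·) = M_{v,j,s·k_v}` — the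
Heisenberg commutation relation the Weil representation realises on the Levi factor. -/
theorem adelicCoordChar_comp_smulMap (i : SplitIdx L) (j : Fin 3)
    (s : (basePlaceOf L i.1).adicCompletion (maximalRealSubfield L)) (k : Model L) :
    (adelicCoordChar ψ hψc i j s).comp (smulMap k) =
      adelicCoordChar ψ hψc i j (s * ((unitAt k i :
        ((basePlaceOf L i.1).adicCompletion (maximalRealSubfield L))ˣ) :
          (basePlaceOf L i.1).adicCompletion (maximalRealSubfield L))) := by
  ext u
  rw [ContinuousMap.comp_apply, smulMap_apply, adelicCoordChar_apply, adelicCoordChar_apply, smul_apply,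
    Pi.smul_apply, smul_eq_mul, mul_assoc]

/-- the SET of adelic coordinate Heisenberg characters of the family `ψ` -/
def coordCharSet : Set C(Space L, Circle) :=
  {χ | ∃ (i : SplitIdx L) (j : Fin 3) (s : (basePlaceOf L i.1).adicCompletion (maximalRealSubfield L)),
    χ = adelicCoordChar ψ hψc i j s}

/-- (Ported verbatim from the HodgeCMPerL package; no docstring in the source.) -/
theorem adelicCoordChar_mem_coordCharSet (i : SplitIdx L) (j : Fin 3)
    (s : (basePlaceOf L i.1).adicCompletion (maximalRealSubfield L)) :
    adelicCoordChar ψ hψc i j s ∈ coordCharSet ψ hψc :=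
  ⟨i, j, s, rfl⟩

/-- the set of coordinate Heisenberg characters is stable under the Levi action -/
theorem comp_smulMap_mem_coordCharSet {χ : C(Space L, Circle)} (hχ : χ ∈ coordCharSet ψ hψc)
    (k : Model L) : χ.comp (smulMap k) ∈ coordCharSet ψ hψc := by
  obtain ⟨i, j, s, rfl⟩ := hχ
  rw [adelicCoordChar_comp_smulMap]
  exact adelicCoordChar_mem_coordCharSet ψ hψc i j _

/-- **separation**: a point of `X` outside the `k`-th level ball is separated from it by an adelic
coordinate Heisenberg character with multiplier in any prescribed dense sequence — here Mathlib's
`denseSeq` of the (separable) local field — provided every `ψ_v` is non-trivial. -/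
theorem exists_adelicCoordChar_sep (hψ : ∀ i, ∃ t, ψ i t ≠ 1) (k : ℕ) (u : Space L)
    (hu : u ∉ levelBall L k) :
    ∃ (i : SplitIdx L) (j : Fin 3) (n : ℕ),
      (∀ t ∈ levelBall L k, adelicCoordChar ψ hψc i j
          (TopologicalSpace.denseSeq ((basePlaceOf L i.1).adicCompletion (maximalRealSubfield L)) n) t = 1) ∧
      adelicCoordChar ψ hψc i j
          (TopologicalSpace.denseSeq ((basePlaceOf L i.1).adicCompletion (maximalRealSubfield L)) n) u ≠ 1 := by
  obtain ⟨i, hi⟩ : ∃ i, rad L k i < ‖u i‖ := by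
    by_contra hall
    push Not at hall
    exact hu hall
  obtain ⟨j, hj⟩ : ∃ j, rad L k i < ‖u i j‖ := by
    by_contra hall
    push Not at hall
    exact (lt_irrefl _) (hi.trans_le ((pi_norm_le_iff_of_nonneg (rad_pos L k i).le).2 hall))
  obtain ⟨n, hn1, hn2⟩ :=
    (TopologicalSpace.denseRange_denseSeq ((basePlaceOf L i.1).adicCompletion (maximalRealSubfield L))).exists_mem_open
      (isOpen_mul_sep (ψ i) (hψc i) (rad_pos L k i) (u i j))
      (exists_mul_sep (ψ i) (hψc i) (hψ i) (rad_pos L k i) hj)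
  refine ⟨i, j, n, fun t ht => ?_, by simpa using hn2⟩
  simpa using hn1 (t i j) ((norm_le_pi_norm (t i) j).trans (ht i))

/-! ## §4  Adelic Stone–von Neumann: scalar commutant of the Schrödinger system on `L²(X)` -/


-- port_pkg: scope closed for this part
end Characters
end HodgeCM.PerL34.PureTensor.SchrodingerModel
end
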